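import Literature.Analysis.FluidPDE.KNSSTypeIRateCore
import Literature.Analysis.FluidPDE.KNSSMildDecay
import Literature.Analysis.FluidPDE.OseenDuhamelPointwiseContinuity
import Literature.Analysis.FluidPDE.KNSSTypeIRateVertexCylinder
import Literature.Analysis.FluidPDE.KNSSRegularityGalileanProofs
import HarnessLib

/-!
# KNSS 2009, proof of Theorem 6.2: the vertex estimate from the mildness clause (proved)

Analysis/FluidPDE proofs file (everything proved; no named facts) on the discharge path of the
named fact `Literature.Analysis.FluidPDE.KNSS2009_typeI_rate_vertex` (`KNSSTypeIRateCore.lean`,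
ingredient 3 of Steps 5–6 of the proof of Theorem 6.2 of Koch–Nadirashvili–Seregin–Šverák, Acta
Math. 203 (2009) = arXiv:0709.3599, p. 13). It proves

* `KNSS2009_typeI_rate_vertex_of_mild :
    KNSS2009_mild_of_rMulNorm_bounded → KNSS2009_typeI_rate_vertex`,

i.e. the whole printed vertex argument, leaving as the only input the mildness of the `w⁽ᵏ⁾`
(the representation formula (3.3)), which the source takes from the proof of Theorem 6.1 (last
paragraph, p. 12: a bounded solution satisfying (6.2) has no parasitic part `b(t)` in the
decomposition of Lemma 3.1) and which is the named fact `KNSS2009_mild_of_rMulNorm_bounded`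
(`KNSSMildDecay.lean`). The printed paragraph (p. 13):

> "… `w⁽ᵏ⁾(0,0) → w(0,0)`, which is not immediately obvious since our bound of `sup_x|w⁽ᵏ⁾(x,τ)|`
> may not be uniform as `τ → 0`. However, by (wkbound) the only possible problem may occur due to
> the contribution from the cylinder `𝒞_k`. In the cylinder we can use the bound (wkbound2) to show
> that the contribution of the dangerous part of `w⁽ᵏ⁾` to the representation formula (3.3) is
> negligible (in the limit `k → ∞`). Applying the representation formula (3.3) in `ℝ³ × (-1, 0)`
> with `w⁽ᵏ⁾(x, -1)` as initial datum and `f_{jl} = -w⁽ᵏ⁾_l w⁽ᵏ⁾_j` and using the bound (wkbound2)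
> together with the decay of the kernel (3.8), one sees that it is enough to estimate the integral
> `I(M)` … `I(M) → 0` as `M → ∞` … and therefore (by (3.10)) the sequence `w⁽ᵏ⁾` converges to `w`
> uniformly in `B̄(0,1) × [-1, 0]`."

## The proof, quantitatively

For `A_k < -1` and `-1 < t ≤ 0`, by the mildness fact about the axis through `c_k = -M_k e₁`
(`KNSS2009_mild_of_rMulNorm_bounded.translate`; the decay (6.2) about that axis is (wkbound2)),
`w⁽ᵏ⁾(t, 0) = e^{(t+1)Δ}w⁽ᵏ⁾(-1)(0) - B¹_{-1}(w⁽ᵏ⁾, w⁽ᵏ⁾)(t)(0)`, and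

1. the datum `w⁽ᵏ⁾(-1)` is bounded by `C` ((wkbound3)), so the caloric part moves by at most
   `K_h(C) √(-τ)` between the times `1 + τ ≥ 1/2` and `1`
   (`norm_heatExtension_sub_heatExtension_le_of_bound`, `KNSSRegularityGalileanProofs`);
2. the Duhamel term splits along `ℝ³ = 𝒞_k ⊔ 𝒞_kᶜ` into the Duhamel terms of the truncated
   fields (`oseenDuhamel_eq_add_of_indicator_compl`: bilinearity and absolute convergence);
3. off the cylinder `|w⁽ᵏ⁾| ≤ K` ((wkbound)), and the Duhamel term of fields bounded by `K` has a
   modulus of continuity in time at a point depending only on `K`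
   (`exists_forall_norm_oseenDuhamel_sub_le`, `OseenDuhamelPointwiseContinuity` — the qualitative
   `L^∞` form of (3.10));
4. on the cylinder, (3.8) at the vertex (`‖K(σ, -y)[a,a]‖ ≤ C₀(σ + ‖y‖²)^{-2}‖a‖²`,
   `exists_norm_oseenKernel_vertex_le`) and (wkbound2) bound the Duhamel term by `C₀K²` times the
   cylinder integral of `KNSSTypeIRateVertexCylinder`, which is `≤ C₁/M_k`
   (`setLIntegral_cylinder_vertexMajorant_le`: the printed `I(M) → 0`, with rate `1/M`), uniformly
   in `t ∈ (-1, 0]` (`exists_norm_oseenDuhamel_cylinder_vertex_le`);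

so for `τ ∈ [-δ, 0]`, `δ = min(δ_heat, δ_Duhamel)`, and `k` large (`A_k < -1`, `C₀C₁K²/M_k ≤ ε/6`),
`‖w⁽ᵏ⁾(0,0) - w⁽ᵏ⁾(τ,0)‖ ≤ ε/3 + ε/3 + ε/6 + ε/6 = ε`.

## References

* G. Koch, N. Nadirashvili, G. Seregin, V. Šverák, *Liouville theorems for the Navier–Stokes
  equations and applications*, Acta Math. 203 (2009) 83–105 = arXiv:0709.3599 (arXiv pages):
  proof of Theorem 6.2, last paragraph, p. 13; (3.3), (3.8), (3.10), pp. 6–7; Theorem 6.1, proof,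
  last paragraph, p. 12. [KochNadirashviliSereginSverak2009]
-/

noncomputable section

open MeasureTheory Set Function Filter TopologicalSpace
open _root_.Topology
open scoped ENNReal NNReal

namespace Literature.Analysis.FluidPDE

/-! ### Helpers: kernel decay at the vertex, spatial truncations -/

section Vertex

/-- **Kernel decay (3.8) at the vertex, squared datum**: with the constant `C₀` of
`exists_norm_oseenKernel_le` in dimension three, `‖K(σ, 0 - y)[a, a]‖ ≤ C₀ (σ + ‖y‖²)^{-2} ‖a‖²`
for `σ > 0` (KNSS 2009, (3.8): `|K_{ijk}(x, t)| ≤ C(|x|² + t)^{-(n+1)/2}`, `n = 3`). [cite: KochNadirashviliSereginSverak2009, §3 (3.8) (arXiv p. 6)] -/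
theorem exists_norm_oseenKernel_vertex_le :
    ∃ C₀ : ℝ, 0 < C₀ ∧ ∀ ⦃σ : ℝ⦄, 0 < σ → ∀ y a : EuclideanSpace ℝ (Fin 3),
      ‖oseenKernel σ (0 - y) a a‖ ≤ C₀ * ((σ + ‖y‖ ^ 2) ^ 2)⁻¹ * ‖a‖ ^ 2 := by
  obtain ⟨C₀, hC₀, hK⟩ := exists_norm_oseenKernel_le (E := EuclideanSpace ℝ (Fin 3))
  refine ⟨C₀, hC₀, fun σ hσ y a => ?_⟩
  have h := hK hσ (0 - y) a a
  have hfin : (Module.finrank ℝ (EuclideanSpace ℝ (Fin 3)) : ℝ) = 3 := by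
    rw [finrank_euclideanSpace_fin]; norm_num
  rw [hfin, zero_sub, norm_neg, show (-((3 + 1 : ℝ) / 2)) = -(2 : ℝ) by norm_num,
    Real.rpow_neg (by positivity), Real.rpow_two] at h
  rw [zero_sub]
  calc ‖oseenKernel σ (-y) a a‖ ≤ C₀ * ((σ + ‖y‖ ^ 2) ^ 2)⁻¹ * ‖a‖ * ‖a‖ := h
    _ = C₀ * ((σ + ‖y‖ ^ 2) ^ 2)⁻¹ * ‖a‖ ^ 2 := by ring

/-- Joint measurability of a spatially truncated field: if `u` is continuous on `(a, b) × ℝ³`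
and `O` is measurable, then `(τ, y) ↦ 1_O(y) u(τ, y)` is a.e. strongly measurable on
`(s, T) × ℝ³ ⊆ (a, b) × ℝ³`. [folklore] -/
theorem aestronglyMeasurable_uncurry_indicator_space
    {u : ℝ → EuclideanSpace ℝ (Fin 3) → EuclideanSpace ℝ (Fin 3)} {a b s T : ℝ}
    (hu : ContinuousOn (uncurry u) (Ioo a b ×ˢ univ)) (has : a ≤ s) (hTb : T ≤ b)
    {O : Set (EuclideanSpace ℝ (Fin 3))}
    (hO : MeasurableSet O) :
    AEStronglyMeasurable (uncurry fun τ y => O.indicator (u τ) y)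
      ((volume : Measure (ℝ × EuclideanSpace ℝ (Fin 3))).restrict (Ioo s T ×ˢ univ)) := by
  have hmeas : AEStronglyMeasurable (uncurry u)
      ((volume : Measure (ℝ × EuclideanSpace ℝ (Fin 3))).restrict (Ioo s T ×ˢ univ)) :=
    (hu.mono (prod_mono (Ioo_subset_Ioo has hTb) subset_rfl)).aestronglyMeasurable
      (measurableSet_Ioo.prod MeasurableSet.univ)
  have heq : (uncurry fun τ y => O.indicator (u τ) y) =
      ((univ : Set ℝ) ×ˢ O).indicator (uncurry u) := by
    funext ⟨τ, y⟩
    by_cases hy : y ∈ O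
    · simp [indicator_of_mem hy, indicator_of_mem (show (τ, y) ∈ (univ : Set ℝ) ×ˢ O from
        ⟨mem_univ _, hy⟩)]
    · simp [indicator_of_notMem hy, indicator_of_notMem (show (τ, y) ∉ (univ : Set ℝ) ×ˢ O from
        fun h => hy h.2)]
  rw [heq]
  exact hmeas.indicator (MeasurableSet.univ.prod hO)

/-- **Splitting the Duhamel term of `w ⊗ w` along a spatial partition.** For a field `u` bounded
and continuous on `(a, b) × ℝ³ ⊇ (s, t) × ℝ³` and a measurable set `O` with complement `Oᶜ`,
`B^ν_s(u,u)(t)(x) = B^ν_s(1_O u, 1_O u)(t)(x) + B^ν_s(1_{Oᶜ} u, 1_{Oᶜ} u)(t)(x)` (the kernel is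
bilinear, and pointwise exactly one of the two truncations is `u`; both truncated Duhamel
integrals converge absolutely). KNSS 2009, p. 13: "the contribution of the dangerous part of
`w⁽ᵏ⁾` to the representation formula". [cite: KochNadirashviliSereginSverak2009, proof of Thm 6.2, last paragraph (arXiv p. 13)] -/
theorem oseenDuhamel_eq_add_of_indicator_compl {ν : ℝ} (hν : 0 < ν)
    {u : ℝ → EuclideanSpace ℝ (Fin 3) → EuclideanSpace ℝ (Fin 3)}
    {a b s t L : ℝ} (hu : ContinuousOn (uncurry u) (Ioo a b ×ˢ univ)) (has : a ≤ s) (htb : t ≤ b)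
    (hst : s < t) (hL : 0 ≤ L) (hbd : ∀ τ ∈ Ioo s t, ∀ y, ‖u τ y‖ ≤ L)
    {O : Set (EuclideanSpace ℝ (Fin 3))}
    (hO : MeasurableSet O) (x : EuclideanSpace ℝ (Fin 3)) :
    oseenDuhamel ν s u u t x =
      oseenDuhamel ν s (fun τ y => O.indicator (u τ) y) (fun τ y => O.indicator (u τ) y) t x +
        oseenDuhamel ν s (fun τ y => Oᶜ.indicator (u τ) y) (fun τ y => Oᶜ.indicator (u τ) y) t x := by
  set uo : ℝ → EuclideanSpace ℝ (Fin 3) → EuclideanSpace ℝ (Fin 3) := fun τ y => O.indicator (u τ) y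
    with huo
  set uc : ℝ → EuclideanSpace ℝ (Fin 3) → EuclideanSpace ℝ (Fin 3) := fun τ y => Oᶜ.indicator (u τ) y
    with huc
  have hum : AEStronglyMeasurable (uncurry u)
      ((volume : Measure (ℝ × EuclideanSpace ℝ (Fin 3))).restrict (Ioo s t ×ˢ univ)) :=
    (hu.mono (prod_mono (Ioo_subset_Ioo has htb) subset_rfl)).aestronglyMeasurable
      (measurableSet_Ioo.prod MeasurableSet.univ)
  have huom := aestronglyMeasurable_uncurry_indicator_space hu has htb hO (s := s) (T := t)
  have hucm := aestronglyMeasurable_uncurry_indicator_space hu has htb hO.compl (s := s) (T := t)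
  have hbo : ∀ τ ∈ Ioo s t, ∀ y, ‖uo τ y‖ ≤ L := by
    intro τ hτ y
    simp only [huo]
    by_cases hy : y ∈ O
    · rw [indicator_of_mem hy]; exact hbd τ hτ y
    · rw [indicator_of_notMem hy, norm_zero]; exact hL
  have hbc : ∀ τ ∈ Ioo s t, ∀ y, ‖uc τ y‖ ≤ L := by
    intro τ hτ y
    simp only [huc]
    by_cases hy : y ∈ Oᶜ
    · rw [indicator_of_mem hy]; exact hbd τ hτ y
    · rw [indicator_of_notMem hy, norm_zero]; exact hL
  -- the three product integrals
  have hI := integrable_oseenKernel_duhamel_bounded hν hum hum hL hbd hbd hst le_rfl x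
  have hIo := integrable_oseenKernel_duhamel_bounded hν huom huom hL hbo hbo hst le_rfl x
  have hIc := integrable_oseenKernel_duhamel_bounded hν hucm hucm hL hbc hbc hst le_rfl x
  rw [oseenDuhamel_eq_integral_prod hν hum hum hL hbd hbd hst le_rfl x,
    oseenDuhamel_eq_integral_prod hν huom huom hL hbo hbo hst le_rfl x,
    oseenDuhamel_eq_integral_prod hν hucm hucm hL hbc hbc hst le_rfl x, ← integral_add hIo hIc]
  refine integral_congr_ae (Eventually.of_forall fun p => ?_)
  change oseenKernel (ν * (t - p.1)) (x - p.2) (u p.1 p.2) (u p.1 p.2) =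
    oseenKernel (ν * (t - p.1)) (x - p.2) (O.indicator (u p.1) p.2) (O.indicator (u p.1) p.2) +
      oseenKernel (ν * (t - p.1)) (x - p.2) (Oᶜ.indicator (u p.1) p.2) (Oᶜ.indicator (u p.1) p.2)
  by_cases hy : p.2 ∈ O
  · have hyc : p.2 ∉ Oᶜ := fun h => h hy
    rw [indicator_of_mem hy, indicator_of_notMem hyc, oseenKernel_zero_left, add_zero]
  · rw [indicator_of_notMem hy, indicator_of_mem (show p.2 ∈ Oᶜ from hy), oseenKernel_zero_left,
      zero_add]

/-- **The cylinder part of the Duhamel term at the vertex is `O(1/M)`** (KNSS 2009, p. 13: "In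
the cylinder we can use the bound (wkbound2) to show that the contribution of the dangerous part of
`w⁽ᵏ⁾` to the representation formula (3.3) is negligible … it is enough to estimate the integral
`I(M)` … `I(M) → 0`"). There is a universal `C₂ > 0` such that: if `M > 0`, `K > 0` and a field
`u` satisfies (wkbound2) `‖u(τ, y)‖ (M√(-τ) + ρ_M(y)) ≤ K M` for `τ ∈ (-1, 0)`, then for every
`-1 < t ≤ 0` the Duhamel term from time `-1` of the truncation `1_{𝒞_M} u` of `u` to the cylinder
`𝒞_M = {ρ_M ≤ M/2}` satisfies `‖B¹_{-1}(1_{𝒞_M}u, 1_{𝒞_M}u)(t)(0)‖ ≤ C₂ K²/M` (kernel decay (3.8)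
at the vertex, `exists_norm_oseenKernel_vertex_le`, and the cylinder integral,
`setLIntegral_cylinder_vertexMajorant_le`; no measurability is needed for the upper bound). [cite: KochNadirashviliSereginSverak2009, proof of Thm 6.2, last paragraph (arXiv p. 13)] -/
theorem exists_norm_oseenDuhamel_cylinder_vertex_le :
    ∃ C₂ : ℝ, 0 < C₂ ∧ ∀ ⦃K M : ℝ⦄ ⦃u : ℝ → EuclideanSpace ℝ (Fin 3) → EuclideanSpace ℝ (Fin 3)⦄,
      0 < K → 0 < M →
      (∀ τ ∈ Ioo (-1 : ℝ) 0, ∀ y,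
        ‖u τ y‖ * (M * Real.sqrt (-τ) + cylRadius (y - EuclideanSpace.single 0 (-M))) ≤ K * M) →
      ∀ ⦃t : ℝ⦄, -1 < t → t ≤ 0 →
        ‖oseenDuhamel 1 (-1)
            (fun τ y =>
              {y : EuclideanSpace ℝ (Fin 3) | cylRadius (y - EuclideanSpace.single 0 (-M)) ≤ M / 2}.indicator
                (u τ) y)
            (fun τ y =>
              {y : EuclideanSpace ℝ (Fin 3) | cylRadius (y - EuclideanSpace.single 0 (-M)) ≤ M / 2}.indicator
                (u τ) y)
            t 0‖ ≤ C₂ * K ^ 2 / M := by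
  obtain ⟨C₀, hC₀, hK0⟩ := exists_norm_oseenKernel_vertex_le
  obtain ⟨C₁, hC₁, hJ⟩ := setLIntegral_cylinder_vertexMajorant_le
  refine ⟨C₀ * C₁, by positivity, fun K M u hK hM hwk t ht1 ht0 => ?_⟩
  set c : EuclideanSpace ℝ (Fin 3) := EuclideanSpace.single 0 (-M) with hc
  set Cyl : Set (EuclideanSpace ℝ (Fin 3)) := {y | cylRadius (y - c) ≤ M / 2} with hCyl
  have hCylm : MeasurableSet Cyl := measurableSet_cylinder M
  set uc : ℝ → EuclideanSpace ℝ (Fin 3) → EuclideanSpace ℝ (Fin 3) := fun τ y => Cyl.indicator (u τ) y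
    with huc
  -- the majorant
  set G : ℝ → EuclideanSpace ℝ (Fin 3) → ℝ≥0∞ := fun τ y =>
    ENNReal.ofReal (((t - τ + ‖y‖ ^ 2) ^ 2)⁻¹) *
    ENNReal.ofReal (M ^ 2 / (M * Real.sqrt (-τ) + cylRadius (y - c)) ^ 2) with hG
  have hpt : ∀ τ ∈ Ioo (-1 : ℝ) t, ∀ y,
      ‖oseenKernel (1 * (t - τ)) (0 - y) (uc τ y) (uc τ y)‖ₑ ≤
        Cyl.indicator (fun y => ENNReal.ofReal (C₀ * K ^ 2) * G τ y) y := by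
    intro τ hτ y
    by_cases hy : y ∈ Cyl
    · rw [indicator_of_mem hy]
      simp only [huc, indicator_of_mem hy, one_mul]
      have hσ : 0 < t - τ := sub_pos.2 hτ.2
      have hτ0 : τ ∈ Ioo (-1 : ℝ) 0 := ⟨hτ.1, hτ.2.trans_le ht0⟩
      set D : ℝ := M * Real.sqrt (-τ) + cylRadius (y - c) with hD
      have hD0 : 0 < D := by
        have h1 : 0 < Real.sqrt (-τ) := Real.sqrt_pos.2 (by linarith [hτ0.2])
        have h2 : 0 ≤ cylRadius (y - c) := cylRadius_nonneg _
        positivity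
      have ha : ‖u τ y‖ ≤ K * M / D := by
        rw [le_div_iff₀ hD0]; exact hwk τ hτ0 y
      have ha2 : ‖u τ y‖ ^ 2 ≤ K ^ 2 * (M ^ 2 / D ^ 2) := by
        calc ‖u τ y‖ ^ 2 ≤ (K * M / D) ^ 2 := pow_le_pow_left₀ (norm_nonneg _) ha 2
          _ = K ^ 2 * (M ^ 2 / D ^ 2) := by ring
      have hk := hK0 hσ y (u τ y)
      rw [← ofReal_norm, hG]
      dsimp only
      rw [← ENNReal.ofReal_mul (by positivity), ← ENNReal.ofReal_mul (by positivity)]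
      refine ENNReal.ofReal_le_ofReal ?_
      calc ‖oseenKernel (t - τ) (0 - y) (u τ y) (u τ y)‖
          ≤ C₀ * ((t - τ + ‖y‖ ^ 2) ^ 2)⁻¹ * ‖u τ y‖ ^ 2 := hk
        _ ≤ C₀ * ((t - τ + ‖y‖ ^ 2) ^ 2)⁻¹ * (K ^ 2 * (M ^ 2 / D ^ 2)) := by
            gcongr
        _ = C₀ * K ^ 2 * (((t - τ + ‖y‖ ^ 2) ^ 2)⁻¹ * (M ^ 2 / D ^ 2)) := by ring
    · rw [indicator_of_notMem hy]
      simp only [huc, indicator_of_notMem hy, oseenKernel_zero_left, enorm_zero, le_refl]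
  -- integrate
  have hslice : ∀ τ ∈ Ioo (-1 : ℝ) t,
      ∫⁻ y, ‖oseenKernel (1 * (t - τ)) (0 - y) (uc τ y) (uc τ y)‖ₑ ≤
        ENNReal.ofReal (C₀ * K ^ 2) * ∫⁻ y in Cyl, G τ y := by
    intro τ hτ
    calc ∫⁻ y, ‖oseenKernel (1 * (t - τ)) (0 - y) (uc τ y) (uc τ y)‖ₑ
        ≤ ∫⁻ y, Cyl.indicator (fun y => ENNReal.ofReal (C₀ * K ^ 2) * G τ y) y :=
          lintegral_mono fun y => hpt τ hτ y
      _ = ENNReal.ofReal (C₀ * K ^ 2) * ∫⁻ y in Cyl, G τ y := by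
          rw [lintegral_indicator hCylm, lintegral_const_mul' _ _ ENNReal.ofReal_ne_top]
  have hmain : ‖oseenDuhamel 1 (-1) uc uc t 0‖ₑ ≤ ENNReal.ofReal (C₀ * K ^ 2 * (C₁ / M)) := by
    calc ‖oseenDuhamel 1 (-1) uc uc t 0‖ₑ
        ≤ ∫⁻ τ in Ioo (-1 : ℝ) t,
            ‖∫ y, oseenKernel (1 * (t - τ)) (0 - y) (uc τ y) (uc τ y)‖ₑ := by
          rw [oseenDuhamel_apply]; exact enorm_integral_le_lintegral_enorm _
      _ ≤ ∫⁻ τ in Ioo (-1 : ℝ) t,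
            ∫⁻ y, ‖oseenKernel (1 * (t - τ)) (0 - y) (uc τ y) (uc τ y)‖ₑ :=
          lintegral_mono fun τ => enorm_integral_le_lintegral_enorm _
      _ ≤ ∫⁻ τ in Ioo (-1 : ℝ) t, ENNReal.ofReal (C₀ * K ^ 2) * ∫⁻ y in Cyl, G τ y :=
          setLIntegral_mono' measurableSet_Ioo hslice
      _ = ENNReal.ofReal (C₀ * K ^ 2) * ∫⁻ τ in Ioo (-1 : ℝ) t, ∫⁻ y in Cyl, G τ y :=
          lintegral_const_mul' _ _ ENNReal.ofReal_ne_top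
      _ ≤ ENNReal.ofReal (C₀ * K ^ 2) * ENNReal.ofReal (C₁ / M) := by
          gcongr
          exact hJ hM ht0
      _ = ENNReal.ofReal (C₀ * K ^ 2 * (C₁ / M)) := (ENNReal.ofReal_mul (by positivity)).symm
  rw [← ofReal_norm] at hmain
  have h := (ENNReal.ofReal_le_ofReal_iff (by positivity)).1 hmain
  calc ‖oseenDuhamel 1 (-1) uc uc t 0‖ ≤ C₀ * K ^ 2 * (C₁ / M) := h
    _ = C₀ * C₁ * K ^ 2 / M := by ring

/-- **KNSS 2009, proof of Theorem 6.2: the vertex estimate from the mildness clause of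
Theorem 6.1.** `KNSS2009_mild_of_rMulNorm_bounded → KNSS2009_typeI_rate_vertex`: along the data of
the blow-up fact, the `w⁽ᵏ⁾` are asymptotically equicontinuous in time at the vertex. Proof (the
printed last paragraph of the proof of Theorem 6.2, arXiv p. 13, made quantitative in `ε/3`'s):
by (wkbound2) and the mildness fact about the axis through `c_k = -M_k e₁`
(`KNSS2009_mild_of_rMulNorm_bounded.translate`), for `A_k < -1` and `-1 < t ≤ 0`,
`w⁽ᵏ⁾(t, 0) = e^{(t+1)Δ}w⁽ᵏ⁾(-1)(0) - B¹_{-1}(w⁽ᵏ⁾, w⁽ᵏ⁾)(t)(0)`; the datum is bounded by `C`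
((wkbound3) at `τ = -1`), so the caloric part moves by at most `K_h √(-τ)` between the times
`1 + τ` and `1` (`norm_heatExtension_sub_heatExtension_le_of_bound`); the Duhamel term splits
along `ℝ³ = 𝒞_k ⊔ 𝒞_kᶜ` (`oseenDuhamel_eq_add_of_indicator_compl`); off the cylinder `|w⁽ᵏ⁾| ≤ K`
(wkbound), so that part has a modulus of continuity in time depending only on `K`
(`exists_forall_norm_oseenDuhamel_sub_le`); and the cylinder part is `O(K²/M_k)` uniformly in
`t ∈ (-1, 0]` (`exists_norm_oseenDuhamel_cylinder_vertex_le`, i.e. (3.8), (wkbound2) and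
`I(M) → 0`). [cite: KochNadirashviliSereginSverak2009, proof of Thm 6.2, last paragraph (arXiv p. 13)] -/
theorem KNSS2009_typeI_rate_vertex_of_mild (hmild : KNSS2009_mild_of_rMulNorm_bounded) :
    KNSS2009_typeI_rate_vertex := by
  intro C K M A B w q hC hK hMpos hMlim hAlim hBpos hw hL hI hoff hmul ε hε
  obtain ⟨C₂, hC₂, hcyl⟩ := exists_norm_oseenDuhamel_cylinder_vertex_le
  -- the heat modulus constant (dimension three, `τ₁ = 1/2`)
  set Kh : ℝ := (1 + 2 * (2 : ℝ) ^ ((Module.finrank ℝ (EuclideanSpace ℝ (Fin 3)) : ℝ) / 2)) *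
    ((2 : ℝ) ^ ((Module.finrank ℝ (EuclideanSpace ℝ (Fin 3)) : ℝ) / 2) * ((1 / 2 : ℝ) / 2) ^ (-(1 / 2 : ℝ)) * C)
    with hKh
  have hKh0 : 0 ≤ Kh := by positivity
  -- `δ₁` for the caloric part, `δ₂` for the off-cylinder Duhamel part
  set η : ℝ := ε / 3 / (Kh + 1) with hη
  have hη0 : 0 < η := by positivity
  set δ₁ : ℝ := min (1 / 2) (η ^ 2) with hδ₁
  have hδ₁pos : 0 < δ₁ := lt_min (by norm_num) (by positivity)
  have hδ₁half : δ₁ ≤ 1 / 2 := min_le_left _ _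
  obtain ⟨δ₂, hδ₂pos, hmod⟩ := exists_forall_norm_oseenDuhamel_sub_le (E := EuclideanSpace ℝ (Fin 3))
    one_pos one_pos hK.le (by positivity : (0 : ℝ) < ε / 3)
  refine ⟨min δ₁ δ₂, lt_min hδ₁pos hδ₂pos, ?_⟩
  -- eventually `A_k < -1` and `C₂ K² / M_k ≤ ε / 6`
  have hev1 : ∀ᶠ k in atTop, A k < -1 := hAlim.eventually_lt_atBot (-1)
  have hev2 : ∀ᶠ k in atTop, C₂ * K ^ 2 / M k ≤ ε / 6 := by
    filter_upwards [hMlim.eventually_ge_atTop (6 * C₂ * K ^ 2 / ε)] with k hk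
    rw [div_le_iff₀ hε] at hk
    rw [div_le_iff₀ (hMpos k)]
    linarith
  filter_upwards [hev1, hev2] with k hk1 hk2 τ hτ
  -- unpack the time
  have hτ0 : τ ≤ 0 := hτ.2
  have hτ1 : -δ₁ ≤ τ := le_trans (neg_le_neg (min_le_left δ₁ δ₂)) hτ.1
  have hτ2 : -δ₂ ≤ τ := le_trans (neg_le_neg (min_le_right δ₁ δ₂)) hτ.1
  have hτm : -1 < τ := by linarith
  -- the data of the `k`-th field
  have hMk := hMpos k
  have hBk := hBpos k
  set c : EuclideanSpace ℝ (Fin 3) := EuclideanSpace.single 0 (-M k) with hc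
  set Cyl : Set (EuclideanSpace ℝ (Fin 3)) := {y | cylRadius (y - c) ≤ M k / 2} with hCyl
  have hCylm : MeasurableSet Cyl := measurableSet_cylinder (M k)
  have hcont : ContinuousOn (uncurry (w k)) (Ioo (A k) (B k) ×ˢ univ) :=
    (hw k).smooth_velocity.continuousOn
  obtain ⟨L, hLk⟩ := hL k
  have hL0 : 0 ≤ L := (norm_nonneg _).trans (hLk 0 ⟨by linarith, le_rfl⟩ 0)
  -- (wkbound2) gives the decay about the axis through `c`
  have hdecay : ∃ D : ℝ, ∀ t ∈ Ioc (A k) 0, ∀ x, cylRadius (x - c) * ‖w k t x‖ ≤ D := by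
    refine ⟨K * M k, fun t ht x => ?_⟩
    have h := hmul k t ht x
    have h1 : 0 ≤ M k * Real.sqrt (-t) := by positivity
    calc cylRadius (x - c) * ‖w k t x‖ = ‖w k t x‖ * cylRadius (x - c) := mul_comm _ _
      _ ≤ ‖w k t x‖ * (M k * Real.sqrt (-t) + cylRadius (x - c)) := by
          gcongr; linarith
      _ ≤ K * M k := h
  -- the representation formula at the vertex for `-1 < t ≤ 0`
  have hrep : ∀ t : ℝ, -1 < t → t ≤ 0 →
      w k t 0 = UnboundedOperators.heatExtension (w k (-1)) (t - (-1)) 0 -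
        oseenDuhamel 1 (-1) (w k) (w k) t 0 := fun t ht1 ht0 =>
    hmild.translate (hw k) (by linarith) hBk ⟨L, hLk⟩ c hdecay hk1 ht1 ht0 0
  -- the split of the Duhamel term along the cylinder
  set wc : ℝ → EuclideanSpace ℝ (Fin 3) → EuclideanSpace ℝ (Fin 3) := fun τ y => Cyl.indicator (w k τ) y
    with hwc
  set wo : ℝ → EuclideanSpace ℝ (Fin 3) → EuclideanSpace ℝ (Fin 3) := fun τ y => Cylᶜ.indicator (w k τ) y
    with hwo
  have hsplit : ∀ t : ℝ, -1 < t → t ≤ 0 →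
      oseenDuhamel 1 (-1) (w k) (w k) t 0 = oseenDuhamel 1 (-1) wc wc t 0 + oseenDuhamel 1 (-1) wo wo t 0 :=
    fun t ht1 ht0 => oseenDuhamel_eq_add_of_indicator_compl one_pos hcont hk1.le (ht0.trans hBk.le)
      ht1 hL0 (fun τ' hτ' y => hLk τ' ⟨by linarith [hτ'.1], hτ'.2.le.trans ht0⟩ y) hCylm 0
  -- (1) the caloric part
  have hheat : ‖UnboundedOperators.heatExtension (w k (-1)) (0 - (-1)) 0 -
      UnboundedOperators.heatExtension (w k (-1)) (τ - (-1)) 0‖ ≤ ε / 3 := by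
    have hm1 : (-1 : ℝ) ∈ Ioo (A k) (B k) := ⟨hk1, by linarith⟩
    have ham : AEStronglyMeasurable (w k (-1)) volume :=
      ((hw k).contDiff_velocity hm1).continuous.aestronglyMeasurable
    have haC : ∀ y, ‖w k (-1) y‖ ≤ C := by
      intro y
      have h := hI k (-1) ⟨hk1, by norm_num⟩ y
      simpa using h
    have h := norm_heatExtension_sub_heatExtension_le_of_bound ham haC (τ₁ := 1 / 2) (τ := 1 + τ)
      (τ' := 1) (by norm_num) (by linarith) (by linarith) 0
    rw [show (1 : ℝ) - (1 + τ) = -τ by ring, ← Real.sqrt_eq_rpow] at h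
    rw [show (0 : ℝ) - (-1) = 1 by ring, show τ - (-1) = 1 + τ by ring]
    refine h.trans ?_
    change Kh * Real.sqrt (-τ) ≤ ε / 3
    have hs : Real.sqrt (-τ) ≤ η := by
      calc Real.sqrt (-τ) ≤ Real.sqrt δ₁ := Real.sqrt_le_sqrt (by linarith)
        _ ≤ Real.sqrt (η ^ 2) := Real.sqrt_le_sqrt (min_le_right _ _)
        _ = η := Real.sqrt_sq hη0.le
    calc Kh * Real.sqrt (-τ) ≤ Kh * η := by gcongr
      _ = ε / 3 * (Kh / (Kh + 1)) := by rw [hη]; field_simp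
      _ ≤ ε / 3 * 1 := by
          gcongr
          rw [div_le_one (by positivity)]; linarith
      _ = ε / 3 := mul_one _
  -- (2) the off-cylinder part
  have hoffp : ‖oseenDuhamel 1 (-1) wo wo 0 0 - oseenDuhamel 1 (-1) wo wo τ 0‖ ≤ ε / 3 := by
    have hwom : AEStronglyMeasurable (uncurry wo)
        ((volume : Measure (ℝ × EuclideanSpace ℝ (Fin 3))).restrict (Ioo (-1) 0 ×ˢ univ)) :=
      aestronglyMeasurable_uncurry_indicator_space hcont hk1.le hBk.le hCylm.compl
    have hwoK : ∀ τ' ∈ Ioo (-1 : ℝ) 0, ∀ y, ‖wo τ' y‖ ≤ K := by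
      intro τ' hτ' y
      simp only [hwo]
      by_cases hy : y ∈ Cylᶜ
      · rw [indicator_of_mem hy]
        exact hoff k τ' ⟨by linarith [hτ'.1], hτ'.2.le⟩ y (lt_of_not_ge hy)
      · rw [indicator_of_notMem hy, norm_zero]; exact hK.le
    exact hmod (by norm_num) hwom hwom hwoK hwoK (by linarith) hτ0 le_rfl (by linarith) 0
  -- (3) the cylinder part
  have hcylp : ∀ t : ℝ, -1 < t → t ≤ 0 → ‖oseenDuhamel 1 (-1) wc wc t 0‖ ≤ ε / 6 := by
    intro t ht1 ht0
    have h := hcyl hK hMk (fun τ' hτ' y => hmul k τ' ⟨by linarith [hτ'.1], hτ'.2.le⟩ y) ht1 ht0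
    exact h.trans hk2
  -- assemble
  set H0 := UnboundedOperators.heatExtension (w k (-1)) (0 - (-1)) 0 with hH0
  set Hτ := UnboundedOperators.heatExtension (w k (-1)) (τ - (-1)) 0 with hHτ
  set P0 := oseenDuhamel 1 (-1) wo wo 0 0 with hP0
  set Pτ := oseenDuhamel 1 (-1) wo wo τ 0 with hPτ
  set Q0 := oseenDuhamel 1 (-1) wc wc 0 0 with hQ0
  set Qτ := oseenDuhamel 1 (-1) wc wc τ 0 with hQτ
  have hdec : w k 0 0 - w k τ 0 = (H0 - Hτ) - (P0 - Pτ) - Q0 + Qτ := by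
    rw [hrep 0 (by norm_num) le_rfl, hrep τ hτm hτ0, hsplit 0 (by norm_num) le_rfl,
      hsplit τ hτm hτ0]
    abel
  rw [hdec]
  calc ‖(H0 - Hτ) - (P0 - Pτ) - Q0 + Qτ‖
      ≤ ‖(H0 - Hτ) - (P0 - Pτ) - Q0‖ + ‖Qτ‖ := norm_add_le _ _
    _ ≤ ‖(H0 - Hτ) - (P0 - Pτ)‖ + ‖Q0‖ + ‖Qτ‖ := by gcongr; exact norm_sub_le _ _
    _ ≤ ‖H0 - Hτ‖ + ‖P0 - Pτ‖ + ‖Q0‖ + ‖Qτ‖ := by gcongr; exact norm_sub_le _ _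
    _ ≤ ε / 3 + ε / 3 + ε / 6 + ε / 6 := by
        linarith [hheat, hoffp, hcylp 0 (by norm_num) le_rfl, hcylp τ hτm hτ0]
    _ = ε := by ring

end Vertex


end Literature.Analysis.FluidPDE

end
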